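import Literature.NumberTheory.NumberFields.ArithmeticEquivalenceSolitaryProofs
import HarnessLib

/-!
# Arithmetically equivalent fields: the normal-closure clause of Perlis' Theorem 1, and two solitary
# families beyond degree `≤ 6` (Galois fields; fields of «cyclic cotype»)

Topic `NumberTheory/NumberFields` (namespace `Literature.NumberTheory.NumberFields`). Theorem-only
companion of `ArithmeticEquivalence.lean` / `ArithmeticEquivalenceSolitaryProofs.lean` (no definition, no
named fact). R. Perlis, *On the equation `ζ_K(s) = ζ_{K'}(s)`*, J. Number Theory **9** (1977) 342–360.

* `IsGassmannEquivalent.le_of_normal_le` — Gassmann equivalent subgroups `H, H'` of a finite group contain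
  the same NORMAL subgroups (a normal subgroup is a union of conjugacy classes, which `H` and `H'` meet in
  the same number of elements);
* `ArithmeticallyEquivalent.nonempty_algHom_of_algHom` — the NORMAL-CLOSURE clause of Perlis' Theorem 1
  («the two fields determine the same normal closure … over `ℚ`», p. 345; the clause the tree's named fact
  `Perlis1977_thm1` leaves out): if `K ↪ N` with `N/ℚ` finite Galois and `K'` is arithmetically equivalent to
  `K`, then `K' ↪ N` [cite: Perlis1977, Thm. 1 (p. 345)];
* `IsGassmannEquivalent.exists_eq_map_conj_of_isCyclic` — Gassmann equivalent subgroups `H, H'` with `H`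
  CYCLIC are conjugate (a generator of `H` has a conjugate in `H'` by the class count; compare orders);
* `algEquiv_of_arithmeticallyEquivalent_of_isCyclic` — hence a number field `K` admitting a finite Galois
  `N/ℚ`, `K ⊆ N`, with `Gal(N/K)` cyclic is SOLITARY (isomorphic to every arithmetically equivalent `K'`);
  in particular Galois number fields are solitary (`algEquiv_of_arithmeticallyEquivalent_of_isGalois`,
  Perlis p. 351 «a normal field is solitary» [cite: Perlis1977, §3 (p. 351, Cor. of Thm. 1)]) and so is `K`
  whenever `[N : K]` is prime (`algEquiv_of_arithmeticallyEquivalent_of_prime`) — e.g. the pure fields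
  `ℚ(a^{1/p})` of prime degree `p ≥ 7` (`N = ℚ(ζ_p, a^{1/p})`, `Gal(N/K) ≅ (ℤ/p)ˣ`), outside the range of
  Perlis' Theorem 3 (`[K : ℚ] ≤ 6`, tree-proved `Perlis1977_thm3_holds`).

Consumer: cell abc-iut, [FrdI] Thm. 6.4 (iv) second clause at the arithmetic Frobenioids
(`Literature/AlgebraicGeometry/Frobenioids/ArithmeticFrobenioidThm64ivSolitary*.lean`), where the base fields are
known to be arithmetically equivalent and the printed clause needs them isomorphic.
-/

noncomputable section
namespace Literature.NumberTheory.NumberFields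

open IntermediateField

/-! ### Group theory: normal subgroups and cyclic subgroups under Gassmann equivalence -/

section Group

variable {G : Type*} [Group G] [Finite G]

/-- **Gassmann equivalent subgroups contain the same normal subgroups.** If `H, H'` are Gassmann
equivalent in the finite group `G` and `M ⊴ G` with `M ≤ H`, then `M ≤ H'`: for `m ∈ M` every `G`-conjugate of
`m` lies in `M ≤ H`, so the injection `{h' ∈ H' : h' ∼ m} ↪ {y ∈ G : y ∼ m} ≃ {h ∈ H : h ∼ m}` between sets of
equal size is onto, and `m ∼ m` is hit. [cite: Perlis1977, Thm. 1 (p. 345, normal closure / normal core clause)] -/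
theorem IsGassmannEquivalent.le_of_normal_le {H H' M : Subgroup G} (hG : IsGassmannEquivalent H H')
    [hM : M.Normal] (hMH : M ≤ H) : M ≤ H' := by
  intro m hm
  -- the comparison map from the `H'`-side count into the set of all conjugates of `m`
  let f : {h : H' // IsConj m (h : G)} → {y : G // IsConj m y} := fun h => ⟨(h.1 : G), h.2⟩
  have hf : Function.Injective f := by
    rintro ⟨⟨a, ha⟩, hca⟩ ⟨⟨b, hb⟩, hcb⟩ hab
    have : a = b := congrArg Subtype.val hab
    subst this
    rfl
  -- every conjugate of `m` lies in `M ≤ H`, so the `H`-side count is the full count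
  let e : {h : H // IsConj m (h : G)} ≃ {y : G // IsConj m y} :=
    { toFun := fun h => ⟨(h.1 : G), h.2⟩
      invFun := fun y => ⟨⟨y.1, hMH (by
          obtain ⟨c, hc⟩ := isConj_iff.mp y.2
          rw [← hc]
          exact hM.conj_mem m hm c)⟩, y.2⟩
      left_inv := fun h => by ext; rfl
      right_inv := fun y => by ext; rfl }
  have hcard : Nat.card {y : G // IsConj m y} ≤ Nat.card {h : H' // IsConj m (h : G)} := by
    rw [← Nat.card_congr e, hG m]
  obtain ⟨⟨h', hc⟩, hh'⟩ := (hf.bijective_of_nat_card_le hcard).2 ⟨m, IsConj.refl m⟩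
  have : (h' : G) = m := congrArg Subtype.val hh'
  rw [← this]
  exact h'.2

/-- **Gassmann equivalent subgroups, one of them cyclic, are conjugate.** If `H = ⟨h₀⟩` and `H'` are
Gassmann equivalent in the finite group `G`, the class of `h₀` meets `H` (in `h₀`), hence meets `H'` in some
`g h₀ g⁻¹`; then `g H g⁻¹ = ⟨g h₀ g⁻¹⟩ ≤ H'` and `#H = #H'` force equality. (So a Gassmann triple `(G, H, H')`
with `H` cyclic is trivial; the smallest non-trivial triples have `[G : H] = 7`, [Perlis1977, §4].)
[cite: Perlis1977, §1 (Lemma 1) and §4 (p. 355)] -/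
theorem IsGassmannEquivalent.exists_eq_map_conj_of_isCyclic {H H' : Subgroup G}
    (hG : IsGassmannEquivalent H H') (hH : IsCyclic H) :
    ∃ g : G, H' = H.map (MulAut.conj g).toMonoidHom := by
  obtain ⟨h₀, hh₀⟩ := (Subgroup.isCyclic_iff_exists_zpowers_eq_top H).mp hH
  have hmem : h₀ ∈ H := by rw [← hh₀]; exact Subgroup.mem_zpowers h₀
  have hpos : 0 < Nat.card {h : H // IsConj h₀ (h : G)} := by
    haveI : Nonempty {h : H // IsConj h₀ (h : G)} := ⟨⟨⟨h₀, hmem⟩, IsConj.refl h₀⟩⟩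
    exact Nat.card_pos
  rw [hG h₀] at hpos
  obtain ⟨⟨h', hc⟩⟩ := (Nat.card_pos_iff.mp hpos).1
  obtain ⟨c, hc'⟩ := isConj_iff.mp hc
  refine ⟨c, ?_⟩
  symm
  apply Subgroup.eq_of_le_of_card_ge
  · rw [← hh₀, MonoidHom.map_zpowers, Subgroup.zpowers_le]
    change c * h₀ * c⁻¹ ∈ H'
    rw [hc']
    exact h'.2
  · rw [Subgroup.card_map_of_injective (MulAut.conj c).injective, hG.card_eq]

end Group

/-! ### The normal-closure clause of Perlis' Theorem 1 -/

section NormalClosure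

/-- **Arithmetically equivalent fields lie in the same Galois extensions of `ℚ`** (normal-closure clause of
Perlis' Theorem 1): if `i : K ↪ N` with `N/ℚ` finite Galois and `K'` is arithmetically equivalent to `K`, then
`K'` embeds in `N`. Proof: in a common finite Galois `N' ⊇ N, K'` the groups of `K` and `K'` are Gassmann
equivalent (the tree's `ArithmeticallyEquivalent.isGassmannEquivalent`, Perlis (b) ⇒ (d)); `Gal(N'/N)` is normal
and contained in `Gal(N'/K)`, hence in `Gal(N'/K')` (`IsGassmannEquivalent.le_of_normal_le`), i.e. `K' ⊆ N`.
[cite: Perlis1977, Thm. 1 (p. 345)] -/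
theorem ArithmeticallyEquivalent.nonempty_algHom_of_algHom {K K' N : Type} [Field K] [NumberField K]
    [Field K'] [NumberField K'] [Field N] [NumberField N] [IsGalois ℚ N] (i : K →ₐ[ℚ] N)
    (h : ArithmeticallyEquivalent K K') : Nonempty (K' →ₐ[ℚ] N) := by
  obtain ⟨N', _, _, _, ⟨j⟩, ⟨i'⟩⟩ := exists_isGalois_algHom₂ N K'
  have hG := h.isGassmannEquivalent (j.comp i) i'
  -- `j(N)` is Galois over `ℚ`; the two `ℚ`-algebra structures on `↥j.fieldRange` (subalgebra / `ℚ`-cast)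
  -- are realigned through `Subsingleton (Algebra ℚ _)`
  haveI : j.fieldRange.fixingSubgroup.Normal :=
    @IsGalois.fixingSubgroup_normal_of_isGalois ℚ N' _ _ _ j.fieldRange _
      (isGalois_of_algebra_eq _ (Subsingleton.elim _ _) (IsGalois.of_algEquiv j.equivFieldRange))
  have hM : j.fieldRange.fixingSubgroup ≤ (j.comp i).fieldRange.fixingSubgroup :=
    IntermediateField.fixingSubgroup_le (by
      rintro _ ⟨x, rfl⟩
      exact ⟨i x, rfl⟩)
  have hM' : j.fieldRange.fixingSubgroup ≤ i'.fieldRange.fixingSubgroup := hG.le_of_normal_le hM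
  have hle : i'.fieldRange ≤ j.fieldRange := by
    rw [← IsGalois.fixedField_fixingSubgroup i'.fieldRange, ← IsGalois.fixedField_fixingSubgroup j.fieldRange]
    exact IntermediateField.fixedField_le hM'
  exact ⟨j.equivFieldRange.symm.toAlgHom.comp
    ((IntermediateField.inclusion hle).comp i'.equivFieldRange.toAlgHom)⟩

/-- Symmetric form: arithmetically equivalent number fields embed into exactly the same finite Galois
extensions of `ℚ` (hence have isomorphic Galois closures). [cite: Perlis1977, Thm. 1 (p. 345)] -/
theorem ArithmeticallyEquivalent.nonempty_algHom_iff {K K' N : Type} [Field K] [NumberField K]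
    [Field K'] [NumberField K'] [Field N] [NumberField N] [IsGalois ℚ N] (h : ArithmeticallyEquivalent K K') :
    Nonempty (K →ₐ[ℚ] N) ↔ Nonempty (K' →ₐ[ℚ] N) :=
  ⟨fun ⟨i⟩ => h.nonempty_algHom_of_algHom i, fun ⟨i'⟩ => h.symm.nonempty_algHom_of_algHom i'⟩

end NormalClosure

/-! ### Solitary families: cyclic cotype, Galois fields, prime relative degree -/

section Solitary

/-- **Fields of cyclic cotype are solitary.** Let `N/ℚ` be a finite Galois extension and `i : K ↪ N` with
`Gal(N/K)` cyclic. Then every number field `K'` arithmetically equivalent to `K` is isomorphic to `K`: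
`K' ↪ N` (normal-closure clause), the groups of `K` and `K'` in `Gal(N/ℚ)` are Gassmann equivalent (Perlis
(b) ⇒ (d), tree-proved), hence conjugate (`IsGassmannEquivalent.exists_eq_map_conj_of_isCyclic`), and
conjugate subgroups have conjugate fixed fields. [cite: Perlis1977, Thm. 1 (p. 345) and §1 (p. 347, «solitary»)] -/
theorem algEquiv_of_arithmeticallyEquivalent_of_isCyclic {K K' N : Type} [Field K] [NumberField K]
    [Field K'] [NumberField K'] [Field N] [NumberField N] [IsGalois ℚ N] (i : K →ₐ[ℚ] N)
    (hcyc : IsCyclic i.fieldRange.fixingSubgroup) (h : ArithmeticallyEquivalent K K') :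
    Nonempty (K ≃ₐ[ℚ] K') := by
  obtain ⟨i'⟩ := h.nonempty_algHom_of_algHom i
  have hG := h.isGassmannEquivalent i i'
  obtain ⟨g, hg⟩ := hG.exists_eq_map_conj_of_isCyclic hcyc
  have hfix : i'.fieldRange = i.fieldRange.map (g : N →ₐ[ℚ] N) := by
    rw [← IsGalois.fixedField_fixingSubgroup i'.fieldRange, hg, fixedField_map_conj,
      IsGalois.fixedField_fixingSubgroup]
  exact ⟨(i.equivFieldRange.trans ((IntermediateField.equivMap i.fieldRange (g : N →ₐ[ℚ] N)).trans
    (IntermediateField.equivOfEq hfix.symm))).trans i'.equivFieldRange.symm⟩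

/-- **Galois number fields are solitary** («a normal field is solitary», Perlis p. 351): a number field
Galois over `ℚ` is isomorphic to every number field arithmetically equivalent to it (cyclic cotype with
`N = K`, `Gal(N/K) = 1`). [cite: Perlis1977, §3 (p. 351)] -/
theorem algEquiv_of_arithmeticallyEquivalent_of_isGalois {K K' : Type} [Field K] [NumberField K]
    [Field K'] [NumberField K'] [IsGalois ℚ K] (h : ArithmeticallyEquivalent K K') :
    Nonempty (K ≃ₐ[ℚ] K') := by
  refine algEquiv_of_arithmeticallyEquivalent_of_isCyclic (AlgHom.id ℚ K) ?_ h
  have htop : (AlgHom.id ℚ K).fieldRange = ⊤ := AlgHom.fieldRange_eq_top.mpr fun x => ⟨x, rfl⟩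
  rw [htop, IntermediateField.fixingSubgroup_top]
  infer_instance

/-- The symmetric statement: a number field arithmetically equivalent to a GALOIS number field `K'` is
isomorphic to it. [cite: Perlis1977, §3 (p. 351)] -/
theorem algEquiv_of_arithmeticallyEquivalent_of_isGalois' {K K' : Type} [Field K] [NumberField K]
    [Field K'] [NumberField K'] [IsGalois ℚ K'] (h : ArithmeticallyEquivalent K K') :
    Nonempty (K ≃ₐ[ℚ] K') := by
  obtain ⟨e⟩ := algEquiv_of_arithmeticallyEquivalent_of_isGalois h.symm
  exact ⟨e.symm⟩

/-- **Prime relative degree.** If `i : K ↪ N` with `N/ℚ` finite Galois and `[N : K]` prime, then `K` is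
solitary (`Gal(N/K)` has prime order, hence is cyclic). Example: `K = ℚ(a^{1/p})` pure of prime degree `p`,
`N = ℚ(ζ_p, a^{1/p})`, `[N : K] = p - 1` is not prime in general — use the cyclic form there; this form covers
e.g. `[N : K] = 2, 3`. [cite: Perlis1977, Thm. 1 (p. 345)] -/
theorem algEquiv_of_arithmeticallyEquivalent_of_prime {K K' N : Type} [Field K] [NumberField K]
    [Field K'] [NumberField K'] [Field N] [NumberField N] [IsGalois ℚ N] (i : K →ₐ[ℚ] N)
    (hp : (Module.finrank i.fieldRange N).Prime) (h : ArithmeticallyEquivalent K K') :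
    Nonempty (K ≃ₐ[ℚ] K') := by
  refine algEquiv_of_arithmeticallyEquivalent_of_isCyclic i ?_ h
  haveI : Fact (Nat.card i.fieldRange.fixingSubgroup).Prime := ⟨by
    rw [IsGalois.card_fixingSubgroup_eq_finrank]; exact hp⟩
  exact isCyclic_of_prime_card rfl

end Solitary

end Literature.NumberTheory.NumberFields

end
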